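import Literature.AnabelianGeometry.SemiGraphs.TreeSystemFixedPointQuotient
import Literature.AnabelianGeometry.SemiGraphs.ArithMaximalCompact

/-!
# Compact subgroups acting on trees COMPATIBLY WITH AN ACTION ON THE BASE ([SemiAnbd] Thm. 5.4 (i), p. 66)

Mochizuki, *Semi-graphs of Anabelioids*, Publ. RIMS **42** (2006) 221–322, §5, Theorem 5.4 (i) and
its proof, manuscript p. 66 [cite: MochizukiSemiAnbd2006, Thm. 5.4(i) p.66]: "Every arithmetically
ample compact subgroup of `π₁^temp(𝔊)` is contained in at least one verticial subgroup. […] Proof.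
Modulo the evident 'arithmetic translation' — e.g., 'nontrivial' is to be replaced by 'arithmetically
ample' and 'estranged' by 'arithmetically estranged' — the proofs are entirely parallel to those of
Theorem 3.7, Corollary 3.9", under the standing hypothesis of Theorem 5.4 "Suppose, moreover, that
the arithmetic actions on the underlying graphs `𝔾`, `ℍ` do not switch the branches of any edge".

PROOF-ONLY companion (no definition, no new named fact) supplying the ARITHMETIC TWIN of the
tree-action engine of the cell's proof of Theorem 3.7 (iii), first part
(`TreeSystemFixedPointTopological.lean`, `TreeSystemFixedPointQuotient.lean`,
`TemperedCompactInVerticialSkeleton.lean`).  There the acting group acts on the trees `𝒢_{∞,j}` OVER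
the base semi-graph `𝔾` (`(ρ g).hom ≫ p = p`), which is what excludes branch switching (print, p. 41:
"Since the action of `H` is over `𝒢`, it follows that if `H` fixes an edge, then it does not switch
the branches of the edge").  In §5 the arithmetic tempered fundamental group `Π^temp_𝔊` ACTS on the
underlying graph `𝔾` through `Π_A` (Def. 5.1 (i)(c): "a natural action by `Π_A` on … the underlying
semi-graph `𝔾`"), the structure morphisms `𝔾_{∞,j} → 𝔾` are only EQUIVARIANT, and branch switching
is excluded by the explicit hypothesis of Theorem 5.4 — exactly the "evident arithmetic translation"
of this step.  Accordingly:

* `SemiGraph.branchMap_eq_of_equivariant` — an endomorphism `σ` of a semi-graph `T` that is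
  EQUIVARIANT over a base endomorphism `τ` of `𝔾` (`σ ≫ p = p ≫ τ`) and fixes the edge of a branch
  fixes the branch, provided `τ` does not switch the branches of any edge of `𝔾` it fixes (the
  morphism `p` is injective on the branches of an edge);
* `SemiGraph.exists_fixed_vertex_of_isCompact_equivariant` — one tree: a compact subgroup `C` of a
  topological group `P` acting on a tree `T` (through a homomorphism with open kernel) equivariantly
  over an action `α : P →* Aut 𝔾` on the base without branch switching fixes a vertex of `T`
  (Lemma 1.8 (ii)(a) for the finite image of `C`, then no branch switching, then "every edge abuts to
  at least one vertex");
* `SemiGraph.exists_compatible_fixed_vertices_of_isCompact_equivariant` — a directed inverse system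
  of such trees with equivariant transition maps and eventually finite fixed-vertex sets has a
  compatible system of `C`-fixed vertices;
* `SemiGraph.exists_compatible_fixed_points_of_quotients_equivariant` — the same pushed down to
  FINITE levels `V_j` (the finite semi-graphs `𝔊_j`), where a compatible system exists by finiteness
  alone (Kőnig);
* `arithCompactInVerticial_conj1_of_levelData` — the ASSEMBLY of the first sentence of Theorem 5.4
  (i) over the data of `ArithMaximalCompact.lean` (abc-iut-L3-t3: `DecompositionData`, `IsVerticial`),
  modulo the arithmetic level data stated as explicit hypotheses (the exact twin of
  `ProfiniteSemiGraph.compactInVerticial_conj1_of_levelData`): if `Π^temp_𝔊` acts on a directed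
  system of trees through open kernels, equivariantly over a branch-switching-free action on `𝔾`,
  with finite levels and equivariant quotient maps, and the pointwise stabiliser of every compatible
  system of level vertices lies in a verticial subgroup, then EVERY compact subgroup of `Π^temp_𝔊`
  (arithmetically ample or not — ampleness is only used in the second sentence of (i)) lies in a
  verticial subgroup.
The case `α = 1` recovers the `…_over` statements of the §3 files (`equivar_one_of_over`,
`noSwap_one` are the two hypothesis conversions).

abc-iut cell, wave-4 seat abc-iut-w4-d040 (L3 standby; offered to abc-iut-L3-lead / abc-iut-L3-t3
as the engine for the Thm 5.4 (i) lemma rows).  Nothing here takes a side on [IUTchIII] Cor. 3.12;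
the statements are [SemiAnbd]'s own elementary combinatorics; typed ≠ proved elsewhere.
-/

namespace Literature.AnabelianGeometry.SemiGraphs

namespace SemiGraph

open CategoryTheory Topology

universe u v w w'

/-! ### No branch switching upstairs from no branch switching downstairs -/

/-- An endomorphism `σ` of `T`, EQUIVARIANT over an endomorphism `τ` of the base `𝔾` along
`p : T ⟶ 𝔾` (`σ ≫ p = p ≫ τ`), that fixes the edge of a branch `b` fixes `b` itself, provided `τ`
fixes every branch of every edge of `𝔾` it fixes ("the arithmetic actions on the underlying graphs …
do not switch the branches of any edge", Thm. 5.4): `σ b` and `b` are branches of one edge whose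
images under `p` are the branches `τ (p b) = p b` and `p b`, and `p` is injective on the branches of
an edge. [cite: MochizukiSemiAnbd2006, Thm. 5.4(i) p.66] -/
theorem branchMap_eq_of_equivariant {T 𝔾 : SemiGraph.{u}} (p : T ⟶ 𝔾) (σ : T ⟶ T) (τ : 𝔾 ⟶ 𝔾)
    (hσ : σ ≫ p = p ≫ τ)
    (hτ : ∀ b' : 𝔾.Branch, τ.edgeMap (𝔾.edgeOf b') = 𝔾.edgeOf b' → τ.branchMap b' = b')
    (b : T.Branch) (he : σ.edgeMap (T.edgeOf b) = T.edgeOf b) : σ.branchMap b = b := by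
  apply p.branchMap_injOn
  · rw [σ.edgeOf_branchMap, he]
  · have hb : p.branchMap (σ.branchMap b) = τ.branchMap (p.branchMap b) :=
      congrFun (congrArg Hom.branchMap hσ) b
    have hedge : p.edgeMap (σ.edgeMap (T.edgeOf b)) = τ.edgeMap (p.edgeMap (T.edgeOf b)) :=
      congrFun (congrArg Hom.edgeMap hσ) (T.edgeOf b)
    rw [hb]
    apply hτ
    rw [p.edgeOf_branchMap, ← hedge, he]

/-- The same for an automorphism `σ` of `T` equivariant over an automorphism `τ` of `𝔾`.
[cite: MochizukiSemiAnbd2006, Thm. 5.4(i) p.66] -/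
theorem branchMap_eq_of_equivariant_aut {T 𝔾 : SemiGraph.{u}} (p : T ⟶ 𝔾) (σ : Aut T) (τ : Aut 𝔾)
    (hσ : σ.hom ≫ p = p ≫ τ.hom)
    (hτ : ∀ b' : 𝔾.Branch, τ.hom.edgeMap (𝔾.edgeOf b') = 𝔾.edgeOf b' → τ.hom.branchMap b' = b')
    (b : T.Branch) (he : σ.hom.edgeMap (T.edgeOf b) = T.edgeOf b) : σ.hom.branchMap b = b :=
  branchMap_eq_of_equivariant p σ.hom τ.hom hσ hτ b he

/-- The tree-level no-switching hypothesis of this file in abc-iut-L3-t3's currency: it follows from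
`NoBranchSwitching` (`ArithMaximalCompact.lean`, the typed form of Thm. 5.4's "the arithmetic actions on
the underlying graphs … do not switch the branches of any edge") for the action `g ↦ (α g).branchMap`
on the branches of `𝔾`. [cite: MochizukiSemiAnbd2006, Thm. 5.4 p.66] -/
theorem noSwap_of_noBranchSwitching {P : Type w} [Group P] {𝔾 : SemiGraph.{u}} (α : P →* Aut 𝔾)
    (h : NoBranchSwitching 𝔾.edgeOf (fun (g : P) (b : 𝔾.Branch) => (α g).hom.branchMap b))
    (g : P) (b' : 𝔾.Branch) (he : (α g).hom.edgeMap (𝔾.edgeOf b') = 𝔾.edgeOf b') :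
    (α g).hom.branchMap b' = b' :=
  h g b' (by rw [(α g).hom.edgeOf_branchMap, he])

/-- Conversely the tree-level hypothesis is exactly `NoBranchSwitching` for that action (so the two
currencies agree). [cite: MochizukiSemiAnbd2006, Thm. 5.4 p.66] -/
theorem noBranchSwitching_of_noSwap {P : Type w} [Group P] {𝔾 : SemiGraph.{u}} (α : P →* Aut 𝔾)
    (h : ∀ (g : P) (b' : 𝔾.Branch),
      (α g).hom.edgeMap (𝔾.edgeOf b') = 𝔾.edgeOf b' → (α g).hom.branchMap b' = b') :
    NoBranchSwitching 𝔾.edgeOf (fun (g : P) (b : 𝔾.Branch) => (α g).hom.branchMap b) :=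
  fun g b he => h g b (by rw [← (α g).hom.edgeOf_branchMap]; exact he)

/-! ### One tree, equivariant over an action on the base -/

/-- **One level of the proof of Thm. 5.4 (i)** (the arithmetic twin of
`exists_fixed_vertex_of_isCompact_over`): a compact subgroup `C` of a topological group `P` acting on
a tree `T` having a vertex, through a homomorphism `ρ` with open kernel ("this action factors through
a finite quotient"), EQUIVARIANTLY (`(ρ g) ≫ p = p ≫ (α g)`) over an action `α` of `P` on the base
`𝔾` which does not switch the branches of any edge, fixes a vertex of `T`: the finite image of `C`
fixes a vertex or an edge (Lemma 1.8 (ii)(a)); a fixed edge has its branches fixed (no switching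
downstairs ⇒ none upstairs) and abuts to a vertex, which is then fixed.
[cite: MochizukiSemiAnbd2006, Thm. 5.4(i) p.66] -/
theorem exists_fixed_vertex_of_isCompact_equivariant {P : Type w} [Group P] [TopologicalSpace P]
    [IsTopologicalGroup P] (C : Subgroup P) (hC : IsCompact (C : Set P))
    {T 𝔾 : SemiGraph.{u}} (hT : T.IsTree) (v₀ : T.Vertex) (p : T ⟶ 𝔾) (ρ : P →* Aut T)
    (hker : IsOpen (ρ.ker : Set P)) (α : P →* Aut 𝔾)
    (hequivar : ∀ g : P, (ρ g).hom ≫ p = p ≫ (α g).hom)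
    (hnoswap : ∀ (g : P) (b' : 𝔾.Branch),
      (α g).hom.edgeMap (𝔾.edgeOf b') = 𝔾.edgeOf b' → (α g).hom.branchMap b' = b') :
    ∃ v : T.Vertex, ∀ c : C, (ρ c).hom.vertexMap v = v := by
  have habut : ∀ e : T.Edge, ∃ b : T.Branch, T.edgeOf b = e ∧ (T.abuts b).isSome :=
    fun e => exists_abuts_of_isConnected ⟨hT.isTree.1⟩ v₀ e
  have hfin : (Set.range (ρ.restrict C)).Finite := finite_range_restrict_of_isCompact ρ hker C hC
  have hnoswap' : ∀ (c : C) (b : T.Branch),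
      (ρ.restrict C c).hom.edgeMap (T.edgeOf b) = T.edgeOf b → (ρ.restrict C c).hom.branchMap b = b :=
    fun c b he => branchMap_eq_of_equivariant_aut p (ρ c) (α c) (hequivar c) (hnoswap c) b he
  exact exists_fixed_vertex_of_noSwap hT habut (ρ.restrict C) hfin hnoswap'

/-! ### An inverse system of trees, equivariant over an action on the base -/

/-- **The compatible system of fixed vertices** (proof of Thm. 5.4 (i) ∥ Thm. 3.7 (iii), p. 41 / p. 66;
the arithmetic twin of `exists_compatible_fixed_vertices_of_isCompact_over`): `P` a topological
group, `C ≤ P` compact; `(T_j)_{j ∈ J}` a directed inverse system of trees over a base `𝔾` carrying an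
action `α` of `P` WITHOUT branch switching, each `T_j` with a vertex and acted on by `P` equivariantly
over `α` through a homomorphism with open kernel, with `P`-equivariant transition maps on vertices; if
above some level `j₀` the sets of `C`-fixed vertices are finite, there is a compatible system
`(x_j)_{j ≥ j₀}` of vertices fixed by `C`. [cite: MochizukiSemiAnbd2006, Thm. 5.4(i) p.66] -/
theorem exists_compatible_fixed_vertices_of_isCompact_equivariant {P : Type w} [Group P]
    [TopologicalSpace P] [IsTopologicalGroup P] (C : Subgroup P) (hC : IsCompact (C : Set P))
    {J : Type v} [Preorder J] [IsDirectedOrder J] (𝔾 : SemiGraph.{u}) (T : J → SemiGraph.{u})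
    (hT : ∀ j, (T j).IsTree) (v₀ : ∀ j, (T j).Vertex) (p : ∀ j, T j ⟶ 𝔾)
    (ρ : ∀ j, P →* Aut (T j)) (hker : ∀ j, IsOpen ((ρ j).ker : Set P)) (α : P →* Aut 𝔾)
    (hequivar : ∀ (j : J) (g : P), (ρ j g).hom ≫ p j = p j ≫ (α g).hom)
    (hnoswap : ∀ (g : P) (b' : 𝔾.Branch),
      (α g).hom.edgeMap (𝔾.edgeOf b') = 𝔾.edgeOf b' → (α g).hom.branchMap b' = b')
    (π : ∀ ⦃i j : J⦄, i ≤ j → (T j).Vertex → (T i).Vertex)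
    (π_id : ∀ (j : J) (x : (T j).Vertex), π le_rfl x = x)
    (π_comp : ∀ ⦃i j k : J⦄ (hij : i ≤ j) (hjk : j ≤ k) (x : (T k).Vertex),
      π hij (π hjk x) = π (hij.trans hjk) x)
    (hequiv : ∀ ⦃i j : J⦄ (h : i ≤ j) (g : P) (x : (T j).Vertex),
      π h ((ρ j g).hom.vertexMap x) = (ρ i g).hom.vertexMap (π h x))
    (j₀ : J)
    (hfixfin : ∀ j, j₀ ≤ j → {x : (T j).Vertex | ∀ c : C, (ρ j c).hom.vertexMap x = x}.Finite) :
    ∃ x : ∀ j : {j : J // j₀ ≤ j}, (T j.1).Vertex,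
      (∀ (j : {j : J // j₀ ≤ j}) (c : C), (ρ j.1 c).hom.vertexMap (x j) = x j) ∧
      ∀ ⦃i j : {j : J // j₀ ≤ j}⦄ (h : i.1 ≤ j.1), π h (x j) = x i := by
  have habut : ∀ (j : J) (e : (T j).Edge), ∃ b : (T j).Branch,
      (T j).edgeOf b = e ∧ ((T j).abuts b).isSome :=
    fun j e => exists_abuts_of_isConnected ⟨(hT j).isTree.1⟩ (v₀ j) e
  have hfin : ∀ j, (Set.range ((ρ j).restrict C)).Finite :=
    fun j => finite_range_restrict_of_isCompact (ρ j) (hker j) C hC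
  have hnoswap' : ∀ (j : J) (c : C) (b : (T j).Branch),
      ((ρ j).restrict C c).hom.edgeMap ((T j).edgeOf b) = (T j).edgeOf b →
        ((ρ j).restrict C c).hom.branchMap b = b :=
    fun j c b he => branchMap_eq_of_equivariant_aut (p j) (ρ j c) (α c) (hequivar j c) (hnoswap c) b he
  exact exists_compatible_fixed_vertices_eventually T hT habut (fun j => (ρ j).restrict C) hfin
    hnoswap' π π_id π_comp (fun i j h c x => hequiv h c x) j₀ hfixfin

/-! ### Pushing down to the finite levels -/

/-- **Compatible fixed vertices of the finite levels** (the arithmetic twin of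
`exists_compatible_fixed_points_of_quotients`): with `P`, `C`, the trees `T_j` equivariant over the
branch-switching-free base action `α` as above, FINITE levels `V_j` carrying `P`-actions `σ_j`,
`P`-equivariant maps `q_j : Vert T_j → V_j` and functorial `P`-equivariant transition maps
`π : V_j → V_i` (`i ≤ j`), there is a compatible family `(x_j)_j`, `x_j ∈ V_j`, of points fixed by
`C`: at each level a `C`-fixed tree vertex exists and is pushed down, so the set of `C`-fixed points
of `V_j` is finite and nonempty, and these sets are stable under the transition maps ("Since the
semi-graphs … are all finite, we thus conclude that we may choose a compatible system", p. 41).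
[cite: MochizukiSemiAnbd2006, Thm. 5.4(i) p.66] -/
theorem exists_compatible_fixed_points_of_quotients_equivariant {P : Type w} [Group P]
    [TopologicalSpace P] [IsTopologicalGroup P] (C : Subgroup P) (hC : IsCompact (C : Set P))
    {J : Type v} [Preorder J] [IsDirectedOrder J] (𝔾 : SemiGraph.{u}) (T : J → SemiGraph.{u})
    (hT : ∀ j, (T j).IsTree) (v₀ : ∀ j, (T j).Vertex) (p : ∀ j, T j ⟶ 𝔾)
    (ρ : ∀ j, P →* Aut (T j)) (hker : ∀ j, IsOpen ((ρ j).ker : Set P)) (α : P →* Aut 𝔾)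
    (hequivar : ∀ (j : J) (g : P), (ρ j g).hom ≫ p j = p j ≫ (α g).hom)
    (hnoswap : ∀ (g : P) (b' : 𝔾.Branch),
      (α g).hom.edgeMap (𝔾.edgeOf b') = 𝔾.edgeOf b' → (α g).hom.branchMap b' = b')
    (V : J → Type w') [∀ j, Finite (V j)] (σ : ∀ j, P → V j → V j)
    (q : ∀ j, (T j).Vertex → V j)
    (hq : ∀ (j : J) (g : P) (x : (T j).Vertex), q j ((ρ j g).hom.vertexMap x) = σ j g (q j x))
    (π : ∀ ⦃i j : J⦄, i ≤ j → V j → V i)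
    (π_id : ∀ (j : J) (x : V j), π le_rfl x = x)
    (π_comp : ∀ ⦃i j k : J⦄ (hij : i ≤ j) (hjk : j ≤ k) (x : V k),
      π hij (π hjk x) = π (hij.trans hjk) x)
    (hequiv : ∀ ⦃i j : J⦄ (h : i ≤ j) (g : P) (x : V j), π h (σ j g x) = σ i g (π h x)) :
    ∃ x : ∀ j, V j, (∀ (j : J) (c : C), σ j c (x j) = x j) ∧
      ∀ ⦃i j : J⦄ (h : i ≤ j), π h (x j) = x i := by
  obtain ⟨x, hx, hcompat⟩ := exists_compatible_of_finite π π_id π_comp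
    (fun j => {y : V j | ∀ c : C, σ j c y = y}) (fun j => Set.toFinite _)
    (fun j => by
      obtain ⟨v, hv⟩ := exists_fixed_vertex_of_isCompact_equivariant C hC (hT j) (v₀ j) (p j) (ρ j)
        (hker j) α (hequivar j) hnoswap
      refine ⟨q j v, fun c => ?_⟩
      have h := hq j c v
      rw [hv c] at h
      exact h.symm)
    (fun i j h y hy c => by
      have e := hequiv h c y
      rw [hy c] at e
      exact e.symm)
  exact ⟨x, fun j c => hx j c, hcompat⟩

/-- An action OVER the base (`(ρ g) ≫ p = p`, the §3 situation of Thm. 3.7 (iii)) is the case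
`α = 1` of an equivariant action, and the trivial action switches no branches — so the §3 engine
`exists_compatible_fixed_points_of_quotients` is the specialisation of the equivariant one (recorded
as the two hypothesis conversions, not as a restatement). [cite: MochizukiSemiAnbd2006, Thm. 3.7(iii) p.41] -/
theorem equivar_one_of_over {P : Type w} [Group P] {T 𝔾 : SemiGraph.{u}} (p : T ⟶ 𝔾)
    (ρ : P →* Aut T) (hover : ∀ g : P, (ρ g).hom ≫ p = p) (g : P) :
    (ρ g).hom ≫ p = p ≫ ((1 : P →* Aut 𝔾) g).hom := by
  rw [hover g, MonoidHom.one_apply]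
  rfl

/-- The trivial action on the base switches no branches. [cite: MochizukiSemiAnbd2006, Thm. 3.7(iii) p.41] -/
theorem noSwap_one {P : Type w} [Group P] {𝔾 : SemiGraph.{u}} (g : P) (b' : 𝔾.Branch)
    (_h : ((1 : P →* Aut 𝔾) g).hom.edgeMap (𝔾.edgeOf b') = 𝔾.edgeOf b') :
    ((1 : P →* Aut 𝔾) g).hom.branchMap b' = b' := rfl

end SemiGraph

/-! ### Theorem 5.4 (i), first sentence, modulo the arithmetic level data -/

section ArithmeticAssembly

open CategoryTheory Topology

universe u v w w' w₁ w₂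

variable {Gtp : Type w} [Group Gtp] [TopologicalSpace Gtp] [IsTopologicalGroup Gtp]
variable {Vx : Type w₁} {Br : Type w₂}

/-- **Theorem 5.4 (i), first sentence, modulo the level data** (p. 66 via p. 41; the arithmetic twin
of `ProfiniteSemiGraph.compactInVerticial_conj1_of_levelData`): let `Π^temp_𝔊 = Gtp` carry chosen
decomposition groups `D : DecompositionData Gtp Vx Br` (abc-iut-L3-t3, `ArithMaximalCompact.lean`)
and act (a) on the underlying semi-graph `𝔾` through `α` WITHOUT switching the branches of any edge
("Suppose, moreover, that the arithmetic actions on the underlying graphs … do not switch the branches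
of any edge"), (b) on a directed system of trees `T_j` (the universal graph-coverings `𝔾_{∞,j}` of the
finite étale Galois coverings `𝔊_j → 𝔊`) through homomorphisms with open kernels, equivariantly over
`α`, and (c) on finite levels `V_j` (the vertices of the `𝔊_j`) compatibly with equivariant quotient
maps and functorial transition maps; suppose (d) the pointwise stabiliser of every compatible system of
level vertices lies in a verticial subgroup (`IsVerticial D`, "the decomposition group of the
pro-vertex").  Then EVERY compact subgroup `K ⊆ Π^temp_𝔊` lies in some verticial subgroup — in
particular every arithmetically ample compact one, which is the printed first sentence of (i).
[cite: MochizukiSemiAnbd2006, Thm. 5.4(i) p.66] -/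
theorem arithCompactInVerticial_conj1_of_levelData (D : DecompositionData Gtp Vx Br)
    (𝔾 : SemiGraph.{u}) (α : Gtp →* Aut 𝔾)
    (hnoswap : ∀ (g : Gtp) (b' : 𝔾.Branch),
      (α g).hom.edgeMap (𝔾.edgeOf b') = 𝔾.edgeOf b' → (α g).hom.branchMap b' = b')
    {J : Type v} [Preorder J] [IsDirectedOrder J] (T : J → SemiGraph.{u})
    (hT : ∀ j, (T j).IsTree) (v₀ : ∀ j, (T j).Vertex) (p : ∀ j, T j ⟶ 𝔾)
    (ρ : ∀ j, Gtp →* Aut (T j)) (hker : ∀ j, IsOpen ((ρ j).ker : Set Gtp))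
    (hequivar : ∀ (j : J) (g : Gtp), (ρ j g).hom ≫ p j = p j ≫ (α g).hom)
    (V : J → Type w') [∀ j, Finite (V j)] (σ : ∀ j, Gtp → V j → V j)
    (q : ∀ j, (T j).Vertex → V j)
    (hq : ∀ (j : J) (g : Gtp) (x : (T j).Vertex), q j ((ρ j g).hom.vertexMap x) = σ j g (q j x))
    (π : ∀ ⦃i j : J⦄, i ≤ j → V j → V i)
    (π_id : ∀ (j : J) (x : V j), π le_rfl x = x)
    (π_comp : ∀ ⦃i j k : J⦄ (hij : i ≤ j) (hjk : j ≤ k) (x : V k),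
      π hij (π hjk x) = π (hij.trans hjk) x)
    (hequiv : ∀ ⦃i j : J⦄ (h : i ≤ j) (g : Gtp) (x : V j), π h (σ j g x) = σ i g (π h x))
    (hident : ∀ x : (∀ j, V j), (∀ ⦃i j : J⦄ (h : i ≤ j), π h (x j) = x i) →
      ∃ W : Subgroup Gtp, IsVerticial D W ∧ ∀ g : Gtp, (∀ j, σ j g (x j) = x j) → g ∈ W)
    (K : Subgroup Gtp) (hK : IsCompact (K : Set Gtp)) :
    ∃ W : Subgroup Gtp, IsVerticial D W ∧ K ≤ W := by
  -- a compatible system of `K`-fixed vertices of the finite levels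
  obtain ⟨x, hx, hcompat⟩ := SemiGraph.exists_compatible_fixed_points_of_quotients_equivariant K hK
    𝔾 T hT v₀ p ρ hker α hequivar hnoswap V σ q hq π π_id π_comp hequiv
  -- its pointwise stabiliser lies in a verticial subgroup, and contains `K`
  obtain ⟨W, hW, hstab⟩ := hident x hcompat
  exact ⟨W, hW, fun g hg => hstab g fun j => hx j ⟨g, hg⟩⟩

/-- **Theorem 5.4 (i), first sentence, in the printed form** (arithmetically ample compact subgroups)
— the special case of `arithCompactInVerticial_conj1_of_levelData`; recorded so that consumers of
`ArithMaximalCompactStatementI D aug` can cite the first conjunct in its own currency.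
[cite: MochizukiSemiAnbd2006, Thm. 5.4(i) p.66] -/
theorem arithCompactInVerticial_conj1_of_levelData_ample {PA : Type w'} [Group PA]
    [TopologicalSpace PA] (D : DecompositionData Gtp Vx Br) (aug : Gtp →* PA)
    (𝔾 : SemiGraph.{u}) (α : Gtp →* Aut 𝔾)
    (hnoswap : ∀ (g : Gtp) (b' : 𝔾.Branch),
      (α g).hom.edgeMap (𝔾.edgeOf b') = 𝔾.edgeOf b' → (α g).hom.branchMap b' = b')
    {J : Type v} [Preorder J] [IsDirectedOrder J] (T : J → SemiGraph.{u})
    (hT : ∀ j, (T j).IsTree) (v₀ : ∀ j, (T j).Vertex) (p : ∀ j, T j ⟶ 𝔾)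
    (ρ : ∀ j, Gtp →* Aut (T j)) (hker : ∀ j, IsOpen ((ρ j).ker : Set Gtp))
    (hequivar : ∀ (j : J) (g : Gtp), (ρ j g).hom ≫ p j = p j ≫ (α g).hom)
    (V : J → Type w') [∀ j, Finite (V j)] (σ : ∀ j, Gtp → V j → V j)
    (q : ∀ j, (T j).Vertex → V j)
    (hq : ∀ (j : J) (g : Gtp) (x : (T j).Vertex), q j ((ρ j g).hom.vertexMap x) = σ j g (q j x))
    (π : ∀ ⦃i j : J⦄, i ≤ j → V j → V i)
    (π_id : ∀ (j : J) (x : V j), π le_rfl x = x)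
    (π_comp : ∀ ⦃i j k : J⦄ (hij : i ≤ j) (hjk : j ≤ k) (x : V k),
      π hij (π hjk x) = π (hij.trans hjk) x)
    (hequiv : ∀ ⦃i j : J⦄ (h : i ≤ j) (g : Gtp) (x : V j), π h (σ j g x) = σ i g (π h x))
    (hident : ∀ x : (∀ j, V j), (∀ ⦃i j : J⦄ (h : i ≤ j), π h (x j) = x i) →
      ∃ W : Subgroup Gtp, IsVerticial D W ∧ ∀ g : Gtp, (∀ j, σ j g (x j) = x j) → g ∈ W)
    (K : Subgroup Gtp) (hK : IsCompact (K : Set Gtp)) (_hKA : IsArithAmple aug K) :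
    ∃ W : Subgroup Gtp, IsVerticial D W ∧ K ≤ W :=
  arithCompactInVerticial_conj1_of_levelData D 𝔾 α hnoswap T hT v₀ p ρ hker hequivar V σ q hq π π_id
    π_comp hequiv hident K hK

end ArithmeticAssembly

end Literature.AnabelianGeometry.SemiGraphs
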